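import Summits.CriticalPhenomena.PercolationContinuityZ3.Theorems.PercNearOneGluingNoHeavyLowerTailThreePointGammaCombPositive
import HarnessLib

/-!
# `NoHeavyLowerTail` (stmt-CriticalPhenomena-4575) — comb positivity, V: the Aas–Gladkov row `AG = qt − e₂(u)` and `Γ₁, Γ₂` are comb-positive too

Support file (prover prim-ineq-gen-2 gen 5; `--supports stmt-CriticalPhenomena-4575`).  One small definition (`K2AG`), no named facts, no sorries.
`AG = Γ + u_a (n_a + n′_a)`: its kernel is `Γ`'s plus the entrywise-NONNEGATIVE kernel of `u_a n_a + u_a n′_a`, so every interval split of `AG` dominates that of `Γ`,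
which is `≥ 0` by `gammaKernel_interval_nonneg` (part IV).  Hence Gladkov's inequality `qt ≥ u_a u_b + u_a u_c + u_b u_c` [Gladkov2024, Thm 2.1] holds COEFFICIENTWISE in the
tensor-Bernstein basis on every finite graph (`agKernel_interval_nonneg`), and so do prim-ineq-gen-2's `Γ₁ = AG − u_a n′_a`, `Γ₂ = AG − u_a n_a`.
-/

noncomputable section

namespace Summit.CriticalPhenomena.PercolationContinuityZ3.Theorems

namespace ThreePointGamma

open Finset Literature.Probability.Percolation Literature.Probability.Percolation.DecisionTree
open Literature.Probability.Percolation.Gladkov ThreePointLB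
open scoped Classical

variable {V : Type*} [Fintype V] [DecidableEq V]

section AG

variable (D : Finset (Sym2 V)) (a b c : V)

/-- Twice the symmetric kernel of `AG − α·u_a n_a − β·u_a n′_a` for `α, β ∈ ℝ` (`α = β = 1`: `Γ`; `α = β = 0`: Gladkov's `AG`; `(0,1)`: `Γ₁`; `(1,0)`: `Γ₂`). [this work] -/
def K2AG (α β : ℝ) (ξ ξ' : Finset (Sym2 V)) : ℝ :=
  K2 D a b c ξ ξ'
  + (1 - α) * (pind (ξ ∈ conn b c ∩ (conn a b)ᶜ ∧ ξ' ∈ (conn a b ∩ conn a c) ∩ pivEv a b c)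
      + pind (ξ ∈ (conn a b ∩ conn a c) ∩ pivEv a b c ∧ ξ' ∈ conn b c ∩ (conn a b)ᶜ))
  + (1 - β) * (pind (ξ ∈ conn b c ∩ (conn a b)ᶜ ∧ ξ' ∈ Qe a b c ∩ sepEv D a b c)
      + pind (ξ ∈ Qe a b c ∩ sepEv D a b c ∧ ξ' ∈ conn b c ∩ (conn a b)ᶜ))

variable {D a b c}

/-- **`AG − α u_a n_a − β u_a n′_a` is comb-positive for all `α, β ≤ 1`**; in particular Gladkov's `AG` (`α = β = 0`), `Γ₁` (`α = 0, β = 1`), `Γ₂` (`α = 1, β = 0`) and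
`Γ` (`α = β = 1`) have all tensor-Bernstein coefficients `≥ 0` on every finite graph. [this work] -/
theorem agKernel_interval_nonneg {α β : ℝ} (hα : α ≤ 1) (hβ : β ≤ 1) {O M : Finset (Sym2 V)} (hO : O ⊆ D) (hM : M ⊆ D) (hOM : Disjoint O M) :
    0 ≤ ∑ R ∈ M.powerset, K2AG D a b c α β (O ∪ R) (O ∪ (M \ R)) := by
  have hΓ := gammaKernel_interval_nonneg (a := a) (b := b) (c := c) hO hM hOM
  have hextra : ∀ R ∈ M.powerset, K2 D a b c (O ∪ R) (O ∪ (M \ R)) ≤ K2AG D a b c α β (O ∪ R) (O ∪ (M \ R)) := by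
    intro R _
    unfold K2AG
    have h1 := pind_nonneg' ((O ∪ R) ∈ conn b c ∩ (conn a b)ᶜ ∧ (O ∪ (M \ R)) ∈ (conn a b ∩ conn a c) ∩ pivEv a b c)
    have h2 := pind_nonneg' ((O ∪ R) ∈ (conn a b ∩ conn a c) ∩ pivEv a b c ∧ (O ∪ (M \ R)) ∈ conn b c ∩ (conn a b)ᶜ)
    have h3 := pind_nonneg' ((O ∪ R) ∈ conn b c ∩ (conn a b)ᶜ ∧ (O ∪ (M \ R)) ∈ Qe a b c ∩ sepEv D a b c)
    have h4 := pind_nonneg' ((O ∪ R) ∈ Qe a b c ∩ sepEv D a b c ∧ (O ∪ (M \ R)) ∈ conn b c ∩ (conn a b)ᶜ)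
    nlinarith [mul_nonneg (sub_nonneg.2 hα) (add_nonneg h1 h2), mul_nonneg (sub_nonneg.2 hβ) (add_nonneg h3 h4)]
  exact hΓ.trans (sum_le_sum hextra)

end AG

end ThreePointGamma

end Summit.CriticalPhenomena.PercolationContinuityZ3.Theorems

end
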